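import Mathlib.Analysis.Calculus.BumpFunction.InnerProduct
import Literature.Barriers.NavierStokesRegularity.LionsExponentSharpness
import Literature.Analysis.FluidPDE.FractionalNSTorusTranslate
import HarnessLib

/-!
# Luo–Titi 2020, Theorem 1 — proof architecture: the main clause as a named fact, and the
  proved consequence clause ("infinitely many weak solutions with initial values zero")

Sibling proof file of the barrier entry
`Literature/Barriers/NavierStokesRegularity/LionsExponentSharpness` (D-0021), working towards the
named fact `LuoTiti2020_infinitelyMany` (= the catalogue entry `LionsExponentSharpness`): for
`θ ∈ [1, 5/4)` and `ν > 0` the fractional system `∂ₜv + ∇·(v⊗v) + ∇p + ν(-Δ)^θ v = 0` on `𝕋³`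
has infinitely many weak solutions in `C⁰_weak(ℝ; L²)` with compact support in time and zero
initial values (Luo–Titi 2020, §1, Theorem 1, "As a consequence" clause).

The printed proof of Theorem 1 (held arXiv text, §2) has two layers:

* **the main clause** (approximation): for every smooth, divergence-free, zero-mean field `u` on
  `ℝ₊ × 𝕋³` with compact support in time and every `ε₀ > 0` there is a weak solution `v` with
  compact support in time and `‖v - u‖_{L^∞_t W^{2θ-1,1}_x} < ε₀` — obtained from the Iteration
  Lemma (§2.1, Lemma 1: one step of the intermittent convex-integration scheme of
  Buckmaster–Vicol, with the hyperviscous error controlled "only for `θ < 5/4`", est. (3.20)) by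
  summing the increments `‖w_{q+1}‖_{L^∞L²} ≤ C δ_{q+1}^{1/2}` in `C⁰_t L²_x`;
* **the consequence clause** (§2, end of the proof of Theorem 1): "Let
  `u(t,x) = φ(t) ∑_{|k|≤N} a_k e^{ik·x}` with `a_k ≠ 0`, `a_k · k = 0`, `a_{-k} = a_k^*` … and
  `φ ∈ C_c^∞(ℝ₊)`. Thus `∇·u = 0` [and `u`] satisfies the conditions of the theorem. Hence there
  exists a weak solution `v` to (1.1) close enough to `u` so that `v ≢ 0`"; infinitely many such
  solutions, and zero initial values, follow because (1.1) is autonomous (time translation,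
  `Torus.IsWeakFracNSSolutionLine.comp_sub_right` of `FractionalNSTorusTranslate`).

This file vendors the main clause as the named fact `LuoTiti2020_thm1` (not proved here: it is
the whole convex-integration construction, resting on `L^p` bounds for the Leray projector and
the Calderón–Zygmund anti-divergence on `𝕋³`, the Littlewood–Paley commutator estimate Lemma 6,
and the intermittent Beltrami flows of Buckmaster–Vicol — none of which Mathlib has) and PROVES
the consequence clause from it:

* `LuoTiti2020.infinitelyMany_of_exists_nonzero` — one weak solution on the line vanishing for
  `t ≤ 0` and for `t ≥ b` and non-zero at one time (witnessed by a non-zero `L²` pairing) yields a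
  sequence of weak solutions with zero initial values, pairwise distinct modulo space–time null
  sets: the translates `v(· - nb)` have disjoint time supports, and weak `L²`-continuity plus
  Cauchy–Schwarz bound `∫‖v(s)‖²` below on a time window, so `∫_ℝ∫‖v_m - v_n‖² > 0`;
* `LuoTiti2020.shearFlow` — the printed test datum with `N = 1`: `u(t,x) = φ(t) cos(2πx₂) e₁`
  (`a_{±e₂} = ½e₁`), a smooth divergence-free zero-mean field supported in `t ∈ [1,3]`, and
  `LuoTiti2020.exists_nonzero_of_thm1` — the fact applied to it with `ε₀ = ¼` gives a weak
  solution whose pairing with `cos(2πx₂) e₁` at the time where `φ = 1` is `≥ ¼`;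
* `LuoTiti2020_infinitelyMany_of_thm1 : LuoTiti2020_thm1 → LuoTiti2020_infinitelyMany` and
  `lionsExponentSharpness_of_thm1`.

## Transcription of the main clause (read before comparing with the printed statement)

* Solutions, torus, symbol: the conventions of `Literature/Analysis/FluidPDE/FractionalNSTorus`
  (unit torus `(ℝ/ℤ)³`, probability Haar measure, symbol `(2π|k|)^{2θ}`; Def. 1.1 is
  `Torus.IsWeakFracNSSolutionLine`; equivalent to the printed `2π`-periodic setting by scaling).
* "`u` smooth on `ℝ₊ × 𝕋³` with compact support in time" is rendered as a field on `ℝ × 𝕋³` with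
  smooth space–time lift vanishing outside a compact interval `[a, b] ⊂ (0, ∞)` (extension by
  zero; the same class of data).
* **The approximation norm is weakened.** The printed `‖v - u‖_{L^∞_t W^{2θ-1,1}_x} < ε₀`
  (`2θ - 1 ≥ 1`; the paper does not spell out its `W^{s,1}` norm) is transcribed by the `L¹`
  closeness `∫_{𝕋³} ‖v(t) - u(t)‖ < ε₀` for every `t`, which the printed estimate implies under
  any standard reading of `W^{s,1}` (`‖f‖_{L¹} ≤ C ‖f‖_{W^{s,1}}`, the constant absorbed into the
  arbitrary `ε₀`). The tree has no `W^{s,1}` scale; the consequence clause uses only this.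
  The vendored fact is therefore WEAKER than Theorem 1 as printed, never stronger.
* "with compact support in time": `v t = 0` for `t ∉ [a', b']` (a representative may be chosen
  to vanish identically there).

## References

* T. Luo, E. S. Titi, *Non-uniqueness of weak solutions to hyperviscous Navier–Stokes equations:
  on sharpness of J.-L. Lions exponent*, Calc. Var. PDE 59 (2020), Paper 92 = arXiv:1808.07595:
  §1 Def. 1.1, Theorem 1; §2.1 Lemma 1 and the proof of Theorem 1. [`LuoTiti2020`]
* T. Buckmaster, V. Vicol, Ann. of Math. 189 (2019), Thms. 1.1–1.3 (the scheme).
  [`BuckmasterVicol2019AnnMath`]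
-/

noncomputable section

open MeasureTheory Set Filter Function
open scoped ENNReal NNReal InnerProductSpace ContDiff
open Literature.Analysis

namespace Literature.Barriers.NavierStokesRegularity

local notation "𝕋³" => UnitAddTorus (Fin 3)
local notation "ℝ³" => EuclideanSpace ℝ (Fin 3)

/-! ## Theorem 1, main clause, as a named fact -/

/-- **Luo–Titi 2020, Theorem 1, main clause** (as printed, §1): "Assume that `θ ∈ [1, 5/4)`.
Suppose `u` is a smooth divergence-free vector field, define[d] on `ℝ₊ × 𝕋³`, with compact
support in time and satisfies the condition `∫_{𝕋³} u(t,x) dx ≡ 0`. Then for any given `ε₀ > 0`,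
there exists a weak solution `v` to the FVNSE (1.1), with compact support in time, satisfying
`‖v - u‖_{L^∞_t W^{2θ-1,1}_x} < ε₀`." Weak solutions are Def. 1.1 (`v ∈ C⁰_weak(ℝ; L²(𝕋³))`
solving (1.1) in the sense of distributions), in-tree `Torus.IsWeakFracNSSolutionLine θ ν`
(`ν > 0` the viscosity of (1.1), unit-torus normalisation). Transcription: `u : ℝ → 𝕋³ → ℝ³`
with smooth space–time lift, divergence free and of zero mean at every time, vanishing outside a
compact time interval `[a, b] ⊂ (0, ∞)`; conclusion: a weak solution on the line vanishing
outside a compact time interval and — WEAKER THAN PRINTED, see the file header — `ε₀`-close to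
`u` in `L¹(𝕋³)` at every time (`∫⁻ ‖v t x - u t x‖ < ε₀`), which the printed `W^{2θ-1,1}`
closeness implies. Proof in the source: §2 from Lemma 1 (the Iteration Lemma) — intermittent
convex integration after Buckmaster–Vicol. Named fact, not proved here.
[cite: LuoTiti2020, §1 Theorem 1 (main clause); proof §2] -/
def LuoTiti2020_thm1 : Prop :=
  ∀ θ ν : ℝ, 1 ≤ θ → θ < 5 / 4 → 0 < ν →
    ∀ u : ℝ → 𝕋³ → ℝ³, ContDiff ℝ ∞ (FunctionSpaces.Torus.stLift u) →
      (∀ t, FunctionSpaces.Torus.IsDivFree (u t)) →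
      (∀ t, FunctionSpaces.Torus.HasZeroMean (u t)) →
      (∃ a b : ℝ, 0 < a ∧ ∀ t, t ∉ Icc a b → u t = 0) →
      ∀ ε₀ : ℝ, 0 < ε₀ →
        ∃ v : ℝ → 𝕋³ → ℝ³, FluidPDE.Torus.IsWeakFracNSSolutionLine θ ν v ∧
          (∃ a' b' : ℝ, ∀ t, t ∉ Icc a' b' → v t = 0) ∧
          ∀ t, ∫⁻ x, ‖v t x - u t x‖ₑ < ENNReal.ofReal ε₀

namespace LuoTiti2020

/-! ## From one non-zero compactly supported weak solution to infinitely many -/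

/-- Cauchy–Schwarz for the pairing of two fields on `𝕋³`, squared and in `[0, ∞]`:
`|∫⟪w, U⟫|² ≤ ∫‖w‖² · ∫‖U‖²`. [folklore] -/
theorem enorm_integral_inner_sq_le {w U : 𝕋³ → ℝ³} (hw : AEStronglyMeasurable w volume)
    (hU : AEStronglyMeasurable U volume) :
    ‖∫ x, ⟪w x, U x⟫_ℝ‖ₑ ^ 2 ≤ FluidPDE.Torus.eL2NormSq w * FluidPDE.Torus.eL2NormSq U := by
  unfold FluidPDE.Torus.eL2NormSq
  set A : ℝ≥0∞ := ∫⁻ x, ‖w x‖ₑ ^ 2 with hA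
  set B : ℝ≥0∞ := ∫⁻ x, ‖U x‖ₑ ^ 2 with hB
  have h1 : ‖∫ x, ⟪w x, U x⟫_ℝ‖ₑ ≤ ∫⁻ x, ‖w x‖ₑ * ‖U x‖ₑ := by
    refine (enorm_integral_le_lintegral_enorm _).trans (lintegral_mono fun x => ?_)
    rw [← ofReal_norm, ← ofReal_norm, ← ofReal_norm, ← ENNReal.ofReal_mul (norm_nonneg _)]
    exact ENNReal.ofReal_le_ofReal (norm_inner_le_norm _ _)
  have h2 : ∫⁻ x, ‖w x‖ₑ * ‖U x‖ₑ ≤ A ^ (1 / 2 : ℝ) * B ^ (1 / 2 : ℝ) := by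
    have h := ENNReal.lintegral_mul_le_Lp_mul_Lq volume Real.HolderConjugate.two_two hw.enorm hU.enorm
    simpa only [Pi.mul_apply, ENNReal.rpow_two, one_div, hA, hB] using h
  have h3 : (A ^ (1 / 2 : ℝ) * B ^ (1 / 2 : ℝ)) ^ 2 = A * B := by
    rw [mul_pow, ← ENNReal.rpow_two, ← ENNReal.rpow_two, ← ENNReal.rpow_mul, ← ENNReal.rpow_mul]
    norm_num
  calc ‖∫ x, ⟪w x, U x⟫_ℝ‖ₑ ^ 2 ≤ (A ^ (1 / 2 : ℝ) * B ^ (1 / 2 : ℝ)) ^ 2 := by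
        gcongr
        exact h1.trans h2
    _ = A * B := h3

/-- `∫⁻‖U‖² < ∞` for `U ∈ L²(𝕋³; ℝ³)`. [folklore] -/
theorem eL2NormSq_lt_top {U : 𝕋³ → ℝ³} (hU : MemLp U 2 volume) : FluidPDE.Torus.eL2NormSq U < ⊤ := by
  have h := lintegral_rpow_enorm_lt_top_of_eLpNorm_lt_top two_ne_zero ENNReal.ofNat_ne_top
    hU.eLpNorm_lt_top
  simpa only [FluidPDE.Torus.eL2NormSq, ENNReal.toReal_ofNat, ENNReal.rpow_two] using h

/-- **Infinitely many weak solutions with zero initial values from one** (the step "in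
particular, there are infinitely many weak solutions with initial values zero" of Luo–Titi's
Theorem 1, made explicit). Let `v` be a weak solution on the line (`Torus.IsWeakFracNSSolutionLine`)
with `v t = 0` for `t ≤ 0` and for `t ≥ b`, and suppose `∫⟪v(t₀), U⟫ ≠ 0` for some time `t₀` and
some `U ∈ L²`. Then the time translates `vₙ = v(· - nb)` (again weak solutions, the system being
autonomous: `IsWeakFracNSSolutionLine.comp_sub_right`) vanish for `t ≤ 0` and for `t ≥ (n+1)b`,
and are pairwise distinct modulo space–time null sets, `∫_ℝ ∫‖v_m - v_n‖² ≠ 0` for `m ≠ n`: on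
the window `(mb, (m+1)b)` the field `v_n` vanishes (disjoint supports), while by weak continuity
`|∫⟪v(s), U⟫| ≥ ½|∫⟪v(t₀), U⟫|` for `s` near `t₀`, whence (Cauchy–Schwarz) `∫‖v(s)‖²` is bounded
below by a positive constant on an interval of positive length.
[cite: LuoTiti2020, §1 Theorem 1, consequence clause; §2 end of the proof of Theorem 1] -/
theorem infinitelyMany_of_exists_nonzero {θ ν : ℝ} {v : ℝ → 𝕋³ → ℝ³}
    (hv : FluidPDE.Torus.IsWeakFracNSSolutionLine θ ν v) (h0 : ∀ t : ℝ, t ≤ 0 → v t = 0) {b : ℝ}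
    (hb : ∀ t : ℝ, b ≤ t → v t = 0) {U : 𝕋³ → ℝ³} (hU : MemLp U 2 volume) {t₀ : ℝ}
    (hne : ∫ x, ⟪v t₀ x, U x⟫_ℝ ≠ 0) :
    ∃ w : ℕ → ℝ → 𝕋³ → ℝ³,
      (∀ n, FluidPDE.Torus.IsWeakFracNSSolutionLine θ ν (w n)) ∧
      (∀ n, (∀ t : ℝ, t ≤ 0 → w n t = 0) ∧ ∃ b : ℝ, ∀ t : ℝ, b ≤ t → w n t = 0) ∧
      ∀ m n, m ≠ n → ∫⁻ t, FluidPDE.Torus.eL2NormSq (w m t - w n t) ≠ 0 := by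
  have hzero : ∀ s, v s = 0 → ∫ x, ⟪v s x, U x⟫_ℝ = 0 := fun s hs => by
    simp [hs]
  -- `0 < t₀ < b`
  have ht₀0 : 0 < t₀ := lt_of_not_ge fun h => hne (hzero t₀ (h0 t₀ h))
  have ht₀b : t₀ < b := lt_of_not_ge fun h => hne (hzero t₀ (hb t₀ h))
  have hb0 : 0 < b := ht₀0.trans ht₀b
  -- weak continuity of the pairing, and a window around `t₀` inside `(0, b)`
  set g : ℝ → ℝ := fun s => ∫ x, ⟪v s x, U x⟫_ℝ with hg_def
  have hgc : Continuous g := hv.2.2.1 U hU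
  set η : ℝ := |g t₀| / 2 with hη_def
  have hgt₀ : 0 < |g t₀| := abs_pos.2 hne
  have hη0 : 0 < η := by positivity
  obtain ⟨δ, hδ0, hδ⟩ := Metric.continuous_iff.1 hgc t₀ η hη0
  set lo : ℝ := max 0 (t₀ - δ) with hlo_def
  set hi : ℝ := min b (t₀ + δ) with hhi_def
  have hlo : lo < t₀ := max_lt ht₀0 (by linarith)
  have hhi : t₀ < hi := lt_min ht₀b (by linarith)
  -- the positive lower bound `c ≤ ∫⁻‖v s‖²` on the window
  set K : ℝ≥0∞ := FluidPDE.Torus.eL2NormSq U with hK_def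
  have hKtop : K ≠ ⊤ := (eL2NormSq_lt_top hU).ne
  set c : ℝ≥0∞ := ENNReal.ofReal η ^ 2 / K with hc_def
  have hc0 : c ≠ 0 :=
    (ENNReal.div_pos_iff.2 ⟨pow_ne_zero 2 (ENNReal.ofReal_pos.2 hη0).ne', hKtop⟩).ne'
  have hlow : ∀ s ∈ Ioo lo hi, c ≤ FluidPDE.Torus.eL2NormSq (v s) := by
    intro s hs
    have hsδ : dist s t₀ < δ := by
      rw [Real.dist_eq, abs_sub_lt_iff]
      constructor
      · linarith [hs.2, min_le_right b (t₀ + δ)]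
      · linarith [hs.1, le_max_right 0 (t₀ - δ)]
    have hgs : η ≤ |g s| := by
      have h1 := hδ s hsδ
      rw [Real.dist_eq] at h1
      have h2 := abs_sub_abs_le_abs_sub (g t₀) (g s)
      rw [abs_sub_comm] at h2
      linarith
    have hcs := enorm_integral_inner_sq_le (hv.2.1 s).aestronglyMeasurable hU.aestronglyMeasurable
    refine ENNReal.div_le_of_le_mul (le_trans ?_ hcs)
    gcongr
    rw [Real.enorm_eq_ofReal_abs]
    exact ENNReal.ofReal_le_ofReal hgs
  -- the sequence of translates with disjoint supports
  refine ⟨fun n t => v (t - n * b), fun n => hv.comp_sub_right _, fun n => ⟨?_, b + n * b, ?_⟩, ?_⟩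
  · intro t ht
    have hn : (0 : ℝ) ≤ n * b := by positivity
    exact h0 _ (by linarith)
  · intro t ht
    exact hb _ (by linarith)
  · intro m n hmn
    -- on the window `(lo + m b, hi + m b)` the `n`-th translate vanishes
    have hvan : ∀ t ∈ Ioo (lo + m * b) (hi + m * b), v (t - n * b) = 0 := by
      intro t ht
      have h1 : 0 < t - m * b := by linarith [ht.1, le_max_left 0 (t₀ - δ)]
      have h2 : t - m * b < b := by linarith [ht.2, min_le_left b (t₀ + δ)]
      rcases lt_or_gt_of_ne hmn with hlt | hgt
      · refine h0 _ ?_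
        have hmn' : (m : ℝ) + 1 ≤ n := by exact_mod_cast hlt
        nlinarith
      · refine hb _ ?_
        have hmn' : (n : ℝ) + 1 ≤ m := by exact_mod_cast hgt
        nlinarith
    have hmono : ∫⁻ t, (Ioo (lo + m * b) (hi + m * b)).indicator (fun _ => c) t ≤
        ∫⁻ t, FluidPDE.Torus.eL2NormSq (v (t - m * b) - v (t - n * b)) := by
      refine lintegral_mono fun t => ?_
      by_cases ht : t ∈ Ioo (lo + m * b) (hi + m * b)
      · rw [indicator_of_mem ht, hvan t ht, sub_zero]
        exact hlow (t - m * b) ⟨by linarith [ht.1], by linarith [ht.2]⟩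
      · rw [indicator_of_notMem ht]
        exact bot_le
    rw [lintegral_indicator_const measurableSet_Ioo, Real.volume_Ioo] at hmono
    intro hz
    have hz' : ∫⁻ t, FluidPDE.Torus.eL2NormSq (v (t - m * b) - v (t - n * b)) = 0 := hz
    rw [hz', nonpos_iff_eq_zero, mul_eq_zero] at hmono
    rcases hmono with h | h
    · exact hc0 h
    · rw [ENNReal.ofReal_eq_zero] at h
      linarith

/-! ## The printed test datum: a shear flow `φ(t) cos(2πx₂) e₁` -/

/-- The frequency `e₂ = (0, 1, 0) ∈ ℤ³`. [folklore] -/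
def shearFreq : Fin 3 → ℤ := ![0, 1, 0]

/-- The frequency set `{e₂, -e₂}` of the shear flow (the printed `∑_{|k| ≤ N}` with `N = 1` and
only two non-zero amplitudes). [folklore] -/
def shearModes : Finset (Fin 3 → ℤ) := {shearFreq, -shearFreq}

/-- The amplitudes `a_{±e₂} = ½ e₁ ∈ ℂ³` (real, so `a_{-k} = a_k^*`; orthogonal to `k = ±e₂`, so
`a_k · k = 0`). [folklore] -/
def shearCoeff : (Fin 3 → ℤ) → EuclideanSpace ℂ (Fin 3) :=
  fun _ => FunctionSpaces.EuclideanSpace.complexify (EuclideanSpace.single 0 (1 / 2 : ℝ))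

/-- The shear field `U(x) = Re(½e^{2πix₂} + ½e^{-2πix₂}) e₁ = cos(2πx₂) e₁` on `𝕋³`, as the real
trigonometric polynomial `Torus.realTrigPoly shearModes shearCoeff`. [folklore] -/
def shearField : 𝕋³ → ℝ³ :=
  FunctionSpaces.Torus.realTrigPoly shearModes shearCoeff

/-- `e₂ ≠ -e₂`. [folklore] -/
theorem shearFreq_ne_neg : shearFreq ≠ -shearFreq := by
  intro h
  have h1 := congr_fun h 1
  simp [shearFreq] at h1

/-- `e₂ ≠ 0`. [folklore] -/
theorem shearFreq_ne_zero : shearFreq ≠ 0 := by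
  intro h
  have h1 := congr_fun h 1
  simp [shearFreq] at h1

/-- `shearModes` is symmetric under `k ↦ -k`. [folklore] -/
theorem neg_mem_shearModes : ∀ k ∈ shearModes, -k ∈ shearModes := by
  intro k hk
  simp only [shearModes, Finset.mem_insert, Finset.mem_singleton] at hk ⊢
  rcases hk with rfl | rfl
  · exact Or.inr rfl
  · exact Or.inl (neg_neg _)

/-- The amplitudes are conjugate symmetric (they are real and even in `k`). [folklore] -/
theorem isConjSymm_shearCoeff : FunctionSpaces.Torus.IsConjSymm shearCoeff := fun _ =>
  (FunctionSpaces.EuclideanSpace.conjVec_complexify _).symm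

/-- The amplitudes are transversal: `k · a_k = 0` on `shearModes`. [folklore] -/
theorem isTransversal_shearCoeff : FunctionSpaces.Torus.IsTransversal shearModes shearCoeff := by
  intro k hk
  simp only [shearModes, Finset.mem_insert, Finset.mem_singleton] at hk
  rcases hk with rfl | rfl <;>
    simp [shearCoeff, shearFreq, Fin.sum_univ_three]

/-- Each amplitude has norm `½`. [folklore] -/
theorem norm_shearCoeff (k : Fin 3 → ℤ) : ‖shearCoeff k‖ = 1 / 2 := by
  rw [shearCoeff, FunctionSpaces.EuclideanSpace.norm_complexify, EuclideanSpace.single, PiLp.norm_single,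
    Real.norm_eq_abs, abs_of_pos (by norm_num)]

/-- The shear field is smooth. [folklore] -/
theorem isSmooth_shearField : FunctionSpaces.Torus.IsSmooth shearField :=
  FunctionSpaces.Torus.isSmooth_realTrigPoly _ _

/-- The shear field is divergence free. [folklore] -/
theorem isDivFree_shearField : FunctionSpaces.Torus.IsDivFree shearField :=
  FunctionSpaces.Torus.isDivFree_realTrigPoly isTransversal_shearCoeff

/-- `∫_{𝕋³} ‖U‖² = ½`. [folklore] -/
theorem integral_norm_sq_shearField : ∫ x, ‖shearField x‖ ^ 2 = 1 / 2 := by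
  rw [shearField, FunctionSpaces.Torus.integral_norm_sq_realTrigPoly neg_mem_shearModes isConjSymm_shearCoeff,
    shearModes, Finset.sum_pair shearFreq_ne_neg, norm_shearCoeff, norm_shearCoeff]
  norm_num

/-- `‖U(x)‖ ≤ 1` pointwise. [folklore] -/
theorem norm_shearField_le_one (x : 𝕋³) : ‖shearField x‖ ≤ 1 := by
  rw [shearField, FunctionSpaces.Torus.norm_realTrigPoly_apply neg_mem_shearModes isConjSymm_shearCoeff,
    FunctionSpaces.Torus.trigPoly_apply, shearModes, Finset.sum_pair shearFreq_ne_neg]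
  refine (norm_add_le _ _).trans ?_
  have h : ∀ k : Fin 3 → ℤ, ‖UnitAddTorus.mFourier k x • shearCoeff k‖ ≤ 1 / 2 := fun k => by
    rw [norm_smul, norm_shearCoeff]
    have := (UnitAddTorus.mFourier k).norm_coe_le_norm x
    rw [UnitAddTorus.mFourier_norm] at this
    nlinarith [norm_nonneg (UnitAddTorus.mFourier k x)]
  linarith [h shearFreq, h (-shearFreq)]

/-- The shear field has zero mean: `∫_{𝕋³} U = 0` (its frequencies are non-zero). [folklore] -/
theorem integral_shearField : ∫ x, shearField x = 0 := by
  have hint : ∀ k : Fin 3 → ℤ,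
      Integrable (fun x : 𝕋³ => UnitAddTorus.mFourier k x • shearCoeff k) volume :=
    fun k => (FunctionSpaces.Torus.isSmooth_mFourier_smul k (shearCoeff k)).integrable
  have h1 : ∫ x, FunctionSpaces.Torus.trigPoly shearModes shearCoeff x = 0 := by
    simp only [FunctionSpaces.Torus.trigPoly_apply]
    rw [integral_finsetSum _ fun k _ => hint k]
    refine Finset.sum_eq_zero fun k hk => ?_
    rw [integral_smul_const, FunctionSpaces.Torus.integral_mFourier]
    have hk0 : k ≠ 0 := by
      simp only [shearModes, Finset.mem_insert, Finset.mem_singleton] at hk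
      rcases hk with rfl | rfl
      · exact shearFreq_ne_zero
      · exact neg_ne_zero.2 shearFreq_ne_zero
    simp [hk0]
  have h2 : ∫ x, shearField x = FunctionSpaces.EuclideanSpace.realPart
      (∫ x, FunctionSpaces.Torus.trigPoly shearModes shearCoeff x) := by
    rw [shearField, FunctionSpaces.Torus.realTrigPoly_eq_comp]
    exact (ContinuousLinearMap.integral_comp_comm _
      (FunctionSpaces.Torus.isSmooth_trigPoly shearModes shearCoeff).integrable)
  rw [h2, h1, map_zero]

/-- The time cut-off `φ`: a smooth bump centred at `t = 2`, equal to `1` on `[3/2, 5/2]` and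
vanishing outside `(1, 3)` (the printed `φ ∈ C_c^∞(ℝ₊)`). [folklore] -/
def bump : ContDiffBump (2 : ℝ) := ⟨1 / 2, 1, by norm_num, by norm_num⟩

/-- **The printed test datum** `u(t, x) = φ(t) cos(2πx₂) e₁` (Luo–Titi's
`φ(t) ∑_{|k|≤N} a_k e^{ik·x}` with `N = 1`, `a_{±e₂} = ½e₁`).
[cite: LuoTiti2020, §2, end of the proof of Theorem 1] -/
def shearFlow : ℝ → 𝕋³ → ℝ³ := fun t x => bump t • shearField x

/-- `φ = 0` outside `[1, 3]`. [folklore] -/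
theorem bump_eq_zero {t : ℝ} (ht : t ∉ Icc (1 : ℝ) 3) : (bump : ℝ → ℝ) t = 0 := by
  refine bump.zero_of_le_dist ?_
  rw [Real.dist_eq]
  simp only [mem_Icc, not_and_or, not_le] at ht
  change (1 : ℝ) ≤ |t - 2|
  rcases ht with h | h
  · rw [abs_of_neg (by linarith)]; linarith
  · rw [abs_of_pos (by linarith)]; linarith

/-- `φ(2) = 1`. [folklore] -/
theorem bump_two : (bump : ℝ → ℝ) 2 = 1 :=
  bump.one_of_mem_closedBall (Metric.mem_closedBall_self (by norm_num [bump]))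

/-- The shear flow has a smooth space–time lift. [folklore] -/
theorem contDiff_stLift_shearFlow : ContDiff ℝ ∞ (FunctionSpaces.Torus.stLift shearFlow) := by
  have h : FunctionSpaces.Torus.stLift shearFlow = fun p : ℝ × EuclideanSpace ℝ (Fin 3) =>
      (bump : ℝ → ℝ) p.1 • FunctionSpaces.Torus.lift shearField p.2 := rfl
  rw [h]
  exact (bump.contDiff.comp contDiff_fst).smul (isSmooth_shearField.comp contDiff_snd)

/-- Constant multiples of `C¹` divergence-free fields on `𝕋³` are divergence free. [folklore] -/
theorem isDivFree_const_smul_of_isContDiff {V : 𝕋³ → ℝ³} (hV : FunctionSpaces.Torus.IsContDiff 1 V)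
    (hdiv : FunctionSpaces.Torus.IsDivFree V) (a : ℝ) : FunctionSpaces.Torus.IsDivFree (a • V) := by
  intro x
  unfold FunctionSpaces.Torus.divergence
  have h : ∀ i, FunctionSpaces.Torus.partialDeriv i (fun y => (a • V) y i) x =
      a * FunctionSpaces.Torus.partialDeriv i (fun y => V y i) x := fun i => by
    have hVi : FunctionSpaces.Torus.IsContDiff 1 (fun y => V y i) :=
      (EuclideanSpace.proj i : ℝ³ →L[ℝ] ℝ).contDiff.comp hV
    have hfun : (fun y => (a • V) y i) = a • fun y => V y i := by
      funext y; simp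
    rw [hfun, FunctionSpaces.Torus.partialDeriv_const_smul hVi]
    rfl
  simp_rw [h, ← Finset.mul_sum]
  have := hdiv x
  unfold FunctionSpaces.Torus.divergence at this
  rw [this, mul_zero]

/-- The shear flow is divergence free at every time. [folklore] -/
theorem isDivFree_shearFlow (t : ℝ) : FunctionSpaces.Torus.IsDivFree (shearFlow t) :=
  isDivFree_const_smul_of_isContDiff (isSmooth_shearField.isContDiff (by simp))
    isDivFree_shearField _

/-- The shear flow has zero mean at every time. [folklore] -/
theorem hasZeroMean_shearFlow (t : ℝ) : FunctionSpaces.Torus.HasZeroMean (shearFlow t) := by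
  unfold FunctionSpaces.Torus.HasZeroMean
  change ∫ x, (bump : ℝ → ℝ) t • shearField x = 0
  rw [integral_smul, integral_shearField, smul_zero]

/-- The shear flow vanishes outside the time interval `[1, 3]`. [folklore] -/
theorem shearFlow_eq_zero (t : ℝ) (ht : t ∉ Icc (1 : ℝ) 3) : shearFlow t = 0 := by
  funext x
  change (bump : ℝ → ℝ) t • shearField x = 0
  rw [bump_eq_zero ht, zero_smul]

/-- At `t = 2` the shear flow pairs with the shear field to `∫‖U‖² = ½`. [folklore] -/
theorem integral_inner_shearFlow_two : ∫ x, ⟪shearFlow 2 x, shearField x⟫_ℝ = 1 / 2 := by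
  have h : ∀ x, ⟪shearFlow 2 x, shearField x⟫_ℝ = ‖shearField x‖ ^ 2 := fun x => by
    change ⟪(bump : ℝ → ℝ) 2 • shearField x, shearField x⟫_ℝ = _
    rw [bump_two, one_smul, real_inner_self_eq_norm_sq]
  simp_rw [h]
  exact integral_norm_sq_shearField

/-! ## The consequence clause from the main clause -/

/-- **A non-zero weak solution with zero initial values from Theorem 1** (Luo–Titi's "there
exists a weak solution `v` to (1.1) close enough to `u` so that `v ≢ 0`", with `u` the shear flow
and `ε₀ = ¼`, followed by a time translation moving the support into `t > 0`): for `θ ∈ [1,5/4)`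
and `ν > 0` there is a weak solution on the line vanishing for `t ≤ 0` and for `t ≥ b`, whose
pairing with the shear field is non-zero at some time (`|∫⟪v, U⟫ - ½| ≤ ∫‖v - u‖ < ¼` at the
time where `φ = 1`). [cite: LuoTiti2020, §2, end of the proof of Theorem 1] -/
theorem exists_nonzero_of_thm1 (h : LuoTiti2020_thm1) {θ ν : ℝ} (h1 : 1 ≤ θ) (h2 : θ < 5 / 4)
    (hν : 0 < ν) :
    ∃ v : ℝ → 𝕋³ → ℝ³, FluidPDE.Torus.IsWeakFracNSSolutionLine θ ν v ∧ (∀ t : ℝ, t ≤ 0 → v t = 0) ∧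
      (∃ b : ℝ, ∀ t : ℝ, b ≤ t → v t = 0) ∧ ∃ t₀ : ℝ, ∫ x, ⟪v t₀ x, shearField x⟫_ℝ ≠ 0 := by
  obtain ⟨v, hv, ⟨a', b', hsupp⟩, hclose⟩ := h θ ν h1 h2 hν shearFlow contDiff_stLift_shearFlow
    isDivFree_shearFlow hasZeroMean_shearFlow ⟨1, 3, one_pos, shearFlow_eq_zero⟩ (1 / 4) (by norm_num)
  have hsf : Continuous shearField := isSmooth_shearField.continuous
  have hv2 : MemLp (v 2) 2 volume := hv.2.1 2
  have hu2 : Continuous (shearFlow 2) := by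
    change Continuous fun x => (bump : ℝ → ℝ) 2 • shearField x
    exact (continuous_const (y := (bump : ℝ → ℝ) 2)).smul hsf
  have hmeas : AEStronglyMeasurable (fun x => v 2 x - shearFlow 2 x) volume :=
    hv2.aestronglyMeasurable.sub hu2.aestronglyMeasurable
  -- the pairing of `v 2` with the shear field is within `¼` of `½`
  have hint1 : Integrable (fun x => ⟪v 2 x, shearField x⟫_ℝ) volume := by
    refine Integrable.mono' (hv2.integrable one_le_two).norm
      (hv2.aestronglyMeasurable.inner hsf.aestronglyMeasurable) (ae_of_all _ fun x => ?_)
    exact (norm_inner_le_norm _ _).trans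
      (mul_le_of_le_one_right (norm_nonneg _) (norm_shearField_le_one x))
  have hint2 : Integrable (fun x => ⟪shearFlow 2 x, shearField x⟫_ℝ) volume :=
    (hu2.inner hsf).integrable_unitAddTorus
  have hL1 : ∫ x, ‖v 2 x - shearFlow 2 x‖ < 1 / 4 := by
    rw [integral_norm_eq_lintegral_enorm hmeas]
    exact ENNReal.toReal_lt_of_lt_ofReal (hclose 2)
  have hdiff : |(∫ x, ⟪v 2 x, shearField x⟫_ℝ) - 1 / 2| ≤ 1 / 4 := by
    rw [← integral_inner_shearFlow_two, ← integral_sub hint1 hint2]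
    have heq : ∫ x, (⟪v 2 x, shearField x⟫_ℝ - ⟪shearFlow 2 x, shearField x⟫_ℝ) =
        ∫ x, ⟪v 2 x - shearFlow 2 x, shearField x⟫_ℝ :=
      integral_congr_ae (ae_of_all _ fun x => (inner_sub_left _ _ _).symm)
    rw [heq, ← Real.norm_eq_abs]
    refine (norm_integral_le_of_norm_le
      ((hv2.integrable one_le_two).sub hu2.integrable_unitAddTorus).norm
      (ae_of_all _ fun x => ?_)).trans hL1.le
    exact (norm_inner_le_norm _ _).trans
      (mul_le_of_le_one_right (norm_nonneg _) (norm_shearField_le_one x))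
  have hne : ∫ x, ⟪v 2 x, shearField x⟫_ℝ ≠ 0 := by
    intro h0
    rw [h0] at hdiff
    norm_num at hdiff
  -- translate so that the support lies in `t > 0`
  refine ⟨fun t => v (t + (a' - 1)), hv.comp_add_right _, ?_, ⟨b' - a' + 2, ?_⟩, 3 - a', ?_⟩
  · intro t ht
    exact hsupp _ fun hm => by linarith [hm.1]
  · intro t ht
    exact hsupp _ fun hm => by linarith [hm.2]
  · have h3 : 3 - a' + (a' - 1) = 2 := by ring
    dsimp only
    rw [h3]
    exact hne

end LuoTiti2020

/-- **Luo–Titi 2020, Theorem 1: the consequence clause from the main clause** ("As a consequence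
there are infinitely many weak solutions of the FVNSE (1.1) which are compactly supported in time;
in particular, there are infinitely many weak solutions with initial values zero"): the named fact
`LuoTiti2020_thm1` implies the catalogue's named fact `LuoTiti2020_infinitelyMany`. Lean content:
the printed shear-flow datum, `ε₀ = ¼`, a time translation, and disjointly supported translates
(`LuoTiti2020.exists_nonzero_of_thm1`, `LuoTiti2020.infinitelyMany_of_exists_nonzero`).
[cite: LuoTiti2020, §1 Theorem 1 and §2, end of the proof of Theorem 1] -/
theorem LuoTiti2020_infinitelyMany_of_thm1 (h : LuoTiti2020_thm1) : LuoTiti2020_infinitelyMany := by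
  intro θ ν h1 h2 hν
  obtain ⟨v, hv, h0, ⟨b, hb⟩, t₀, hne⟩ := LuoTiti2020.exists_nonzero_of_thm1 h h1 h2 hν
  exact LuoTiti2020.infinitelyMany_of_exists_nonzero hv h0 hb
    (LuoTiti2020.isSmooth_shearField.memLp 2) hne

/-- The barrier `LionsExponentSharpness` from the main clause of Luo–Titi's Theorem 1.
[cite: LuoTiti2020, §1 Theorem 1] -/
theorem lionsExponentSharpness_of_thm1 (h : LuoTiti2020_thm1) : LionsExponentSharpness :=
  LuoTiti2020_infinitelyMany_of_thm1 h

end Literature.Barriers.NavierStokesRegularity
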